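import Literature.NumberTheory.LFunctions.MertensSecondUpperChain
import HarnessLib

/-!
# RH-FREE kernel certificate — «nothing here bears on the truth of RH»
# Rosser–Schoenfeld's (3.18) below `3 659 203`: certified run, chunks 6–10

Topic: `Literature/NumberTheory/LFunctions`. Pure proof file (kernel computation; nothing is asserted, no
definition). Each `runK` evaluates `MertensSecondUpperChain.runD 15333` — `15333` steps of the upper chain of
`MertensSecondUpperChain.lean` along the prime table `ChainTable.table`, each certifying the primality of the next
entry `p'`, performing the comparison `cmp` for the old state (which gives
`Σ_{q ≤ x} 1/q < log log x + B + 1/(2 log² x)` on `[p, p') ∩ [286, ∞)`), and extending the enclosure of `log p'`,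
the lower bound of `log log p'` and the upper bound of the sum. This file: primes `974317 → 2063741`. The four files
`MertensSecondUpperChainRun1–4.lean` (chunks 1–17, primes `3 → 3659203`) cover Rosser–Schoenfeld's tabular range of
(3.18) up to Dusart's analytic threshold `3 594 641` (assembly: `MertensSecondUpperErrorBound.lean`). The expected
states were obtained by evaluating the same function compiled (`#eval` on the Lean farm, 2026-08-28; all 17
comparisons pass). `decide +kernel`, standard axioms only (`maxHeartbeats 0`; ≈ 30 s of kernel time per chunk).

## References
* J. B. Rosser, L. Schoenfeld, Illinois J. Math. 6 (1962), 64–94: Thm 5 (3.18), p. 70; Thm 20 and §8 p. 87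
  (the tabular range). [RosserSchoenfeld1962]
-/

namespace Literature.NumberTheory.LFunctions.MertensSecondUpperChainRun

open MertensSecondUpperChain

set_option maxHeartbeats 0 in
/-- **Chunk 6 of the certified upper run** (primes `974317` to `1187003`).
[cite: RosserSchoenfeld1962, Thm. 5 (3.18) and Thm. 20 (tabular range)] -/
theorem run6 :
    runD 15333
      ⟨974317, 16670472908117788623345073, 16670472908118264231339505,
        3172108739028779049147925, 3488323133211273941413028⟩ =
    some ⟨1187003, 16909175564208126273551012, 16909175564208601881927236,
        3189296450592738651757824, 3505530369138245270327886⟩ := by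
  decide +kernel

set_option maxHeartbeats 0 in
/-- **Chunk 7 of the certified upper run** (primes `1187003` to `1403239`).
[cite: RosserSchoenfeld1962, Thm. 5 (3.18) and Thm. 20 (tabular range)] -/
theorem run7 :
    runD 15333
      ⟨1187003, 16909175564208126273551012, 16909175564208601881927236,
        3189296450592738651757824, 3505530369138245270327886⟩ =
    some ⟨1403239, 17111491104877457981529406, 17111491104877933590283172,
        3203675202055072481491292, 3519876797461292710470313⟩ := by
  decide +kernel

set_option maxHeartbeats 0 in
/-- **Chunk 8 of the certified upper run** (primes `1403239` to `1621729`).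
[cite: RosserSchoenfeld1962, Thm. 5 (3.18) and Thm. 20 (tabular range)] -/
theorem run8 :
    runD 15333
      ⟨1403239, 17111491104877457981529406, 17111491104877933590283172,
        3203675202055072481491292, 3519876797461292710470313⟩ =
    some ⟨1621729, 17286434431633557415409340, 17286434431634033024532673,
        3215972183114260955873480, 3532156314953589003893135⟩ := by
  decide +kernel

set_option maxHeartbeats 0 in
/-- **Chunk 9 of the certified upper run** (primes `1621729` to `1842329`).
[cite: RosserSchoenfeld1962, Thm. 5 (3.18) and Thm. 20 (tabular range)] -/
theorem run9 :
    runD 15333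
      ⟨1621729, 17286434431633557415409340, 17286434431634033024532673,
        3215972183114260955873480, 3532156314953589003893135⟩ =
    some ⟨1842329, 17440618011498367853563031, 17440618011498843463051306,
        3226707198816513289586724, 3542874351878172056604584⟩ := by
  decide +kernel

set_option maxHeartbeats 0 in
/-- **Chunk 10 of the certified upper run** (primes `1842329` to `2063741`).
[cite: RosserSchoenfeld1962, Thm. 5 (3.18) and Thm. 20 (tabular range)] -/
theorem run10 :
    runD 15333
      ⟨1842329, 17440618011498367853563031, 17440618011498843463051306,
        3226707198816513289586724, 3542874351878172056604584⟩ =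
    some ⟨2063741, 17577818788978594365443835, 17577818788979069975295767,
        3236180288846491774256043, 3552377519997539625385999⟩ := by
  decide +kernel

end Literature.NumberTheory.LFunctions.MertensSecondUpperChainRun
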